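import Summits.ValiantsHypothesis.ValiantsHypothesis.Theorems.DivisionGapPerDivisionHardStubSparseRigid

/-!
# Crux `DivisionGap.PerDivisionHard` (stmt-ValiantsHypothesis-5065), line `pair-descent-jss-endpoint` —
stub `stub_pairFlip`, part 1: penalty weights, digit genericity, dominance

Tools for the PAIR-FLIP branch (skeleton v7.2 of
`Cruxes/PerDivisionHard/Lines/pair_descent_jss_endpoint.lean`, dossier v4 §3): weights of the form
`W - q` for an `ℕ`-valued PENALTY `q` vanishing exactly on the face `G`, their `CutsOut` property,
the penalty `Σ_e q e · m e` of a monomial, the top fibre of an atom with at most two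
monomials under such a weight, the place-value penalty (`B^{rank e}` off `G`, `0` on `G`) whose
penalty is `offDigitSum`, and the three-level dominance lemma
`M² u + M v + z = 0 ⇒ u = v = z = 0` for `|v| + |z| < M`.
-/

noncomputable section

-- `Summit.ValiantsHypothesis.ValiantsHypothesis.…` is the tree's mandated single-conjunct layout
-- (Sub = Summit), so the duplicated namespace component is intended.
set_option linter.dupNamespace false

namespace Summit.ValiantsHypothesis.ValiantsHypothesis.Theorems.DivisionGapPerDivisionHard

open MvPolynomial Literature.Computability.AlgebraicComplexity
open Summit.ValiantsHypothesis.ValiantsHypothesis.Theorems.ZeroOneTransfer.Negative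
open scoped NNReal

namespace PairFlip

variable {n : ℕ}

/-! ### Penalties -/

/-- Penalty is additive. [folklore] -/
theorem pen_add (q : Fin n × Fin n → ℕ) (m₁ m₂ : (Fin n × Fin n) →₀ ℕ) :
    (∑ e, q e * (m₁ + m₂) e) = (∑ e, q e * m₁ e) + (∑ e, q e * m₂ e) := by
  simp only [Finsupp.add_apply, mul_add, Finset.sum_add_distrib]

/-- Penalty of a multiple. [folklore] -/
theorem pen_smul (q : Fin n × Fin n → ℕ) (k : ℕ) (m : (Fin n × Fin n) →₀ ℕ) :
    (∑ e, q e * (k • m) e) = k * (∑ e, q e * m e) := by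
  simp only [Finsupp.smul_apply, smul_eq_mul, Finset.mul_sum]
  exact Finset.sum_congr rfl fun e _ => by ring

/-- Penalty of a finite sum. [folklore] -/
theorem pen_finset_sum {α : Type*} (q : Fin n × Fin n → ℕ) (s : Finset α)
    (m : α → (Fin n × Fin n) →₀ ℕ) :
    (∑ e, q e * (∑ x ∈ s, m x) e) = ∑ x ∈ s, ∑ e, q e * (m x) e := by
  classical
  induction s using Finset.induction_on with
  | empty => simp
  | insert a s ha ih => rw [Finset.sum_insert ha, Finset.sum_insert ha, pen_add, ih]

/-- Penalty is additive in the penalty function. [folklore] -/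
theorem pen_add_left (q₁ q₂ : Fin n × Fin n → ℕ) (m : (Fin n × Fin n) →₀ ℕ) :
    (∑ e, (q₁ e + q₂ e) * m e) = (∑ e, q₁ e * m e) + (∑ e, q₂ e * m e) := by
  simp only [add_mul, Finset.sum_add_distrib]

/-- Penalty scales in the penalty function. [folklore] -/
theorem pen_mul_left (c : ℕ) (q : Fin n × Fin n → ℕ) (m : (Fin n × Fin n) →₀ ℕ) :
    (∑ e, (c * q e) * m e) = c * (∑ e, q e * m e) := by
  simp only [Finset.mul_sum]
  exact Finset.sum_congr rfl fun e _ => by ring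

/-- Penalty of an indicator penalty function: the entry at that cell. [folklore] -/
theorem pen_indicator (e₀ : Fin n × Fin n) (m : (Fin n × Fin n) →₀ ℕ) :
    (∑ e, (if e = e₀ then 1 else 0) * m e) = m e₀ := by
  classical
  simp only [ite_mul, one_mul, zero_mul, Finset.sum_ite_eq', Finset.mem_univ, if_true]

/-- Penalty is bounded by `(max q) · degree`. [folklore] -/
theorem pen_le (q : Fin n × Fin n → ℕ) {Q : ℕ} (hQ : ∀ e, q e ≤ Q) (m : (Fin n × Fin n) →₀ ℕ) :
    (∑ e, q e * m e) ≤ Q * m.degree := by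
  rw [Finsupp.degree_eq_sum, Finset.mul_sum]
  exact Finset.sum_le_sum fun e _ => Nat.mul_le_mul_right _ (hQ e)

/-! ### Weights `W - q`: cutting out the face, the top fibre minimises the penalty -/

/-- Weight plus penalty is `W · deg` for the weight `W - q` (`q ≤ W`). [folklore] -/
theorem weight_add_pen (q : Fin n × Fin n → ℕ) {W : ℕ} (hW : ∀ e, q e ≤ W)
    (m : (Fin n × Fin n) →₀ ℕ) :
    Finsupp.weight (fun e => W - q e) m + (∑ e, q e * m e) = W * m.degree := by
  rw [Finsupp.weight_apply, Finsupp.sum_fintype m (fun i c => c • (W - q i)) (fun _ => zero_smul _ _),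
    ← Finset.sum_add_distrib, Finsupp.degree_eq_sum, Finset.mul_sum]
  refine Finset.sum_congr rfl fun e _ => ?_
  rw [smul_eq_mul, mul_comm (q e), ← mul_add, Nat.sub_add_cancel (hW e), mul_comm]

/-- The top fibre of `W - q` minimises the penalty among monomials of the same degree.
[folklore] -/
theorem pen_le_of_mem_support_topComponent (q : Fin n × Fin n → ℕ) {W : ℕ} (hW : ∀ e, q e ≤ W)
    {h : MvPolynomial (Fin n × Fin n) ℝ≥0} {m₁ m₂ : (Fin n × Fin n) →₀ ℕ}
    (hm₁ : m₁ ∈ (topComponent (fun e => W - q e) h).support) (hm₂ : m₂ ∈ h.support)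
    (hdeg : m₁.degree = m₂.degree) : (∑ e, q e * m₁ e) ≤ (∑ e, q e * m₂ e) := by
  have hw₁ := weight_eq_of_mem_support_topComponent (fun e => W - q e) h hm₁
  have hw₂ : Finsupp.weight (fun e => W - q e) m₂ ≤ weightedTotalDegree (fun e => W - q e) h :=
    le_weightedTotalDegree _ hm₂
  have e₁ := weight_add_pen q hW m₁
  have e₂ := weight_add_pen q hW m₂
  rw [hdeg] at e₁
  omega

/-- **A penalty weight cuts out its zero set.**  If `q` vanishes on `G`, is positive off `G`,
`q ≤ W`, and some permutation lies inside `G`, then `W - q` cuts out `G`. [folklore] -/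
theorem cutsOut_sub_pen :
    ∀ (n : ℕ) (G : Finset (Fin n × Fin n)) (q : Fin n × Fin n → ℕ) (W : ℕ),
      (∀ e, q e ≤ W) → (∀ e ∈ G, q e = 0) → (∀ e ∉ G, 0 < q e) →
      (∃ σ₀ : Equiv.Perm (Fin n), ∀ i, (σ₀ i, i) ∈ G) → CutsOut (fun e => W - q e) G := by
  intro n G q W hW hG hpos ⟨σ₀, hσ₀⟩
  -- the weight of a permutation is `n·W - penalty`
  have hwt : ∀ τ : Equiv.Perm (Fin n), ∑ x, (W - q (τ x, x)) + ∑ x, q (τ x, x) = n * W := by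
    intro τ
    rw [← Finset.sum_add_distrib, Finset.sum_congr rfl fun x _ => Nat.sub_add_cancel (hW (τ x, x))]
    simp
  have hin : ∀ τ : Equiv.Perm (Fin n), (∀ x, (τ x, x) ∈ G) → ∑ x, q (τ x, x) = 0 := fun τ hτ =>
    Finset.sum_eq_zero fun x _ => hG _ (hτ x)
  have hout : ∀ τ : Equiv.Perm (Fin n), (∃ x, (τ x, x) ∉ G) → 0 < ∑ x, q (τ x, x) := by
    rintro τ ⟨x, hx⟩
    exact lt_of_lt_of_le (hpos _ hx) (Finset.single_le_sum (f := fun y => q (τ y, y))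
      (fun y _ => Nat.zero_le _) (Finset.mem_univ x))
  intro σ
  constructor
  · intro hσ τ
    show (∑ i, (W - q (τ i, i))) ≤ ∑ i, (W - q (σ i, i))
    have h1 := hwt σ
    have h2 := hwt τ
    have h3 := hin σ hσ
    omega
  · intro hmax
    by_contra hno
    push Not at hno
    have h1 := hwt σ
    have h2 := hwt σ₀
    have h3 := hin σ₀ hσ₀
    have h4 := hout σ hno
    have h5 : (∑ i, (W - q (σ₀ i, i))) ≤ ∑ i, (W - q (σ i, i)) := hmax σ₀
    omega

/-- Monomials of the top fibre of `W - q` have equal penalties when they have equal degrees.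
[folklore] -/
theorem pen_eq_of_mem_support_topComponent (q : Fin n × Fin n → ℕ) {W : ℕ} (hW : ∀ e, q e ≤ W)
    {h : MvPolynomial (Fin n × Fin n) ℝ≥0} {m₁ m₂ : (Fin n × Fin n) →₀ ℕ}
    (hm₁ : m₁ ∈ (topComponent (fun e => W - q e) h).support)
    (hm₂ : m₂ ∈ (topComponent (fun e => W - q e) h).support) (hdeg : m₁.degree = m₂.degree) :
    (∑ e, q e * m₁ e) = (∑ e, q e * m₂ e) :=
  le_antisymm
    (pen_le_of_mem_support_topComponent q hW hm₁ (support_topComponent_subset _ h hm₂) hdeg)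
    (pen_le_of_mem_support_topComponent q hW hm₂ (support_topComponent_subset _ h hm₁) hdeg.symm)

/-- Weight comparison is penalty comparison for equal degrees. [folklore] -/
theorem weight_lt_weight_iff_pen_lt (q : Fin n × Fin n → ℕ) {W : ℕ} (hW : ∀ e, q e ≤ W)
    {m₁ m₂ : (Fin n × Fin n) →₀ ℕ} (hdeg : m₁.degree = m₂.degree) :
    Finsupp.weight (fun e => W - q e) m₁ < Finsupp.weight (fun e => W - q e) m₂ ↔
      (∑ e, q e * m₂ e) < (∑ e, q e * m₁ e) := by
  have e₁ := weight_add_pen q hW m₁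
  have e₂ := weight_add_pen q hW m₂
  rw [hdeg] at e₁
  omega

/-- **The top fibre of a decided atom.**  If `f ∈ supp F` and every other monomial of `F` has
smaller weight, the top-`w` fibre of `F` is `{f}`. [folklore] -/
theorem support_topComponent_eq_singleton (w : Fin n × Fin n → ℕ)
    {F : MvPolynomial (Fin n × Fin n) ℝ≥0} {f : (Fin n × Fin n) →₀ ℕ} (hf : f ∈ F.support)
    (hlt : ∀ d ∈ F.support, d ≠ f → Finsupp.weight w d < Finsupp.weight w f) :
    (topComponent w F).support = {f} := by
  have hF : F ≠ 0 := fun h0 => by simp [h0] at hf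
  have hsub : (topComponent w F).support ⊆ {f} := by
    intro d hd
    have hdF := support_topComponent_subset _ F hd
    rw [Finset.mem_singleton]
    by_contra hne
    have h1 := hlt d hdF hne
    have h2 := weight_eq_of_mem_support_topComponent w F hd
    have h3 : Finsupp.weight w f ≤ weightedTotalDegree w F := le_weightedTotalDegree w hf
    omega
  refine Finset.Subset.antisymm hsub ?_
  obtain ⟨d, hd⟩ := support_nonempty.mpr (topComponent_ne_zero w hF)
  have := Finset.mem_singleton.mp (hsub hd)
  rw [this] at hd
  exact Finset.singleton_subset_iff.mpr hd

/-- The top fibre of an atom with at most two monomials, decided by the penalty: if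
`supp F ⊆ {f, f'}`-wise every other monomial is `f'`, all monomials of `F` have the same degree,
and `(∑ e, q e * f e) < (∑ e, q e * f' e)`, then the top fibre of `W - q` is `{f}`. [folklore] -/
theorem support_topComponent_eq_singleton_of_pen_lt (q : Fin n × Fin n → ℕ) {W : ℕ}
    (hW : ∀ e, q e ≤ W) {F : MvPolynomial (Fin n × Fin n) ℝ≥0} {f : (Fin n × Fin n) →₀ ℕ}
    (hf : f ∈ F.support) (hdeg : ∀ d ∈ F.support, d.degree = f.degree)
    (hother : ∀ d ∈ F.support, d ≠ f → (∑ e, q e * f e) < (∑ e, q e * d e)) :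
    (topComponent (fun e => W - q e) F).support = {f} :=
  support_topComponent_eq_singleton _ hf fun d hd hne =>
    (weight_lt_weight_iff_pen_lt q hW (hdeg d hd)).mpr (hother d hd hne)

/-! ### The place-value penalty `e ↦ if e ∈ G then 0 else B ^ rank e` -/

/-- The place-value penalty of a monomial is its off-`G` digit sum. [folklore] -/
theorem pen_placePen (G : Finset (Fin n × Fin n)) (B : ℕ) (m : (Fin n × Fin n) →₀ ℕ) :
    (∑ e, (if e ∈ G then 0 else B ^ (finProdFinEquiv e : ℕ)) * m e) = offDigitSum G B m := by
  unfold offDigitSum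
  refine Finset.sum_congr rfl fun e _ => ?_
  split_ifs <;> ring

/-- The place-value penalty is positive off `G` (`B ≥ 1`). [folklore] -/
theorem placePen_pos (G : Finset (Fin n × Fin n)) {B : ℕ} (hB : 0 < B) {e : Fin n × Fin n}
    (he : e ∉ G) : 0 < (if e ∈ G then 0 else B ^ (finProdFinEquiv e : ℕ)) := by
  rw [if_neg he]; exact Nat.pow_pos hB

/-- The place-value penalty is at most `B^{n²}` (`B ≥ 1`). [folklore] -/
theorem placePen_le (G : Finset (Fin n × Fin n)) {B : ℕ} (hB : 0 < B) (e : Fin n × Fin n) :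
    (if e ∈ G then 0 else B ^ (finProdFinEquiv e : ℕ)) ≤ B ^ (n * n) := by
  split_ifs
  · exact Nat.zero_le _
  · exact Nat.pow_le_pow_right hB (finProdFinEquiv e).2.le

/-- **Digit genericity of the place-value penalty.**  Two exponent vectors with entries `< B` and
equal place-value penalties agree off `G`. [folklore] -/
theorem eq_offG_of_pen_placePen_eq (G : Finset (Fin n × Fin n)) {B : ℕ}
    {m₁ m₂ : (Fin n × Fin n) →₀ ℕ} (h₁ : ∀ e, m₁ e < B) (h₂ : ∀ e, m₂ e < B)
    (h : (∑ e, (if e ∈ G then 0 else B ^ (finProdFinEquiv e : ℕ)) * m₁ e) =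
      ∑ e, (if e ∈ G then 0 else B ^ (finProdFinEquiv e : ℕ)) * m₂ e) :
    ∀ e ∉ G, m₁ e = m₂ e := by
  rw [pen_placePen, pen_placePen] at h
  exact eq_offG_of_offDigitSum_eq G h₁ h₂ h

/-! ### Dominance -/

/-- **Three-level dominance.**  If `|v| + |z| < M` and `M² u + M v + z = 0` then
`u = 0`, `v = 0` and `z = 0`. [folklore] -/
theorem eq_zero_of_levels {M u v z : ℤ} (hM : |v| + |z| < M) (h : M ^ 2 * u + M * v + z = 0) :
    u = 0 ∧ v = 0 ∧ z = 0 := by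
  have hM0 : 0 < M := lt_of_le_of_lt (add_nonneg (abs_nonneg v) (abs_nonneg z)) hM
  have hv : |v| < M := lt_of_le_of_lt (le_add_of_nonneg_right (abs_nonneg z)) hM
  have hz : |z| < M := lt_of_le_of_lt (le_add_of_nonneg_left (abs_nonneg v)) hM
  have hu : u = 0 := by
    by_contra hu
    have h1 : 1 ≤ |u| := Int.one_le_abs hu
    -- `|M v + z| < M²`
    have h2 : |M * v + z| < M ^ 2 := by
      calc |M * v + z| ≤ |M * v| + |z| := abs_add_le _ _
        _ = M * |v| + |z| := by rw [abs_mul, abs_of_pos hM0]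
        _ < M * |v| + M := by linarith
        _ = M * (|v| + 1) := by ring
        _ ≤ M * M := by
            apply mul_le_mul_of_nonneg_left _ hM0.le
            have := Int.add_one_le_iff.mpr hv
            linarith [abs_nonneg z]
        _ = M ^ 2 := by ring
    have h3 : M ^ 2 ≤ |M ^ 2 * u| := by
      rw [abs_mul, abs_of_nonneg (by positivity : (0 : ℤ) ≤ M ^ 2)]
      nlinarith
    have h4 : M ^ 2 * u = -(M * v + z) := by linarith
    rw [h4, abs_neg] at h3
    linarith
  subst hu
  have h' : M * v + z = 0 := by linarith
  have hv0 : v = 0 := by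
    by_contra hv0
    have h1 : 1 ≤ |v| := Int.one_le_abs hv0
    have h2 : M ≤ |M * v| := by
      rw [abs_mul, abs_of_pos hM0]; nlinarith
    have h3 : M * v = -z := by linarith
    rw [h3, abs_neg] at h2
    linarith
  subst hv0
  exact ⟨rfl, rfl, by linarith⟩

end PairFlip

end Summit.ValiantsHypothesis.ValiantsHypothesis.Theorems.DivisionGapPerDivisionHard

end
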